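import Summits.HodgeConjecture.CorCM.Model.WeilFaceCorners
import Summits.HodgeConjecture.CorCM.Assembly.ModelChain
import Summits.HodgeConjecture.CorCM.Model.WeilLineHodge
import Summits.HodgeConjecture.CorCM.CyclicSexticFaces
import Summits.HodgeConjecture.CorCM.CM.Lemmas
import Summits.HodgeConjecture.CorCM.Model.CMDominated
import Summits.HodgeConjecture.CorCM.AndreTargetsOfRiemann
import Literature.AlgebraicGeometry.HodgeTheory.HodgeTypeExteriorProduct
import Literature.AlgebraicGeometry.HodgeTheory.AbelianVarietyPullbackAlgebraicClasses
import HarnessLib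

/-!
# COR-CM (cell `pub-hodgecm2`): the model's Weil line `W_F(P(f))` read on André's product-form carrier —
# real-carrier algebraicity of `K`-Weil-line classes of the corner realisations ⟹ `U.WeilFaceAlgebraic F f`,
# and hence `U.HC (U.cmProd F Θ)` (modulo Riemann's theorem)

HONEST FRAMING. A JUNCTION (no new mathematics, no case of the Hodge conjecture) between two spellings already in
the tree, so that real-carrier theorems about Weil-LINE classes feed the universe language of the E term.

* Universe side (`CorCM/Geometry/Universe.lean`): the corner product `P = ((A_{Φ₀} × A_{Φ₁}) × A_{Φ₂}) × A_{Φ₃}`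
  (`Universe.prod4`), the Weil generators `pr₀^*y₀ ∪ ⋯ ∪ pr₃^*y₃` (all `yᵢ` in one eigencharacter,
  `Universe.weilGenerators`), the Weil line `W_F(P)` (`Universe.weilLine`) and
  `Universe.WeilFaceAlgebraic F f := W_F(P(f)) ≤ U.alg P(f) 2` (rfwf Thm 1.3 for one face; the currency of
  `Universe.W_RK4` / `Universe.FaceReduction`).
* Real-carrier side (`HodgeTheory/WeilClassesCMReductionProductForm.lean`): the `K`-Weil-line classes
  `weilLineClasses A act k ⊂ Hᵏ(⨁ A; ℂ)` of a finite family with `𝓞_K`-actions — the carrier of the binder `hW`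
  of `AndreProductForm.mem_algebraicClasses_cmTypedProduct` (André 1992 / Milne 2020 Thm 1 in product form, a
  tree THEOREM) and of the blueprint target T1 of `HOME/pub-hodgecm2-lit-andre-3/A1-BLUEPRINT.md`.

PROVED here (theorems only, no definition, axioms trio), for the model universe of record
`U := Model.universeOf hHD hI hU h₃` and the corner realisations `cornerAV h₃ F Φ j` READ OVER `F` (with their
left-nested product, the comparison maps `toBiprod` / `ofBiprod` and the cohomological heart
`FourCorner.map_ofBiprod_gen_mem_weilLineClasses` in the companion file `Model/WeilFaceCorners.lean`):

* `cornerTheta_ofRatClassBaseChange`, `ofRatClassBaseChange_weilGenerator` — the complexification `β` carries the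
  model's `σ`-eigenlines onto the joint `σ`-eigenspaces of `θ_j` (`BettiUniverse.map_eigenspaces_cmEndAction`) and
  the model's Weil generators onto same-character cup monomials (`β` multiplicative and natural);
* `universeOf_hc_iff_hodgeConjectureFor` — `U.HC X ↔ HodgeConjectureFor (U.dim X) (scheme X)` (the tree's
  comparison `Milne1999.hodgeClasses_le_ratAlgebraicClasses_iff_hodgeConjectureFor`);
* **`weilFaceAlgebraic_of_weilLineClasses`** (blueprint T3) and **`weilFaceAlgebraic_of_andreSlots`** (the same fed
  by André's binder `hW` verbatim): IF every rational `(2,2)` class in `weilLineClasses A ι 4 ⊂ H⁴(⨁_j A_j; ℂ)` is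
  algebraic THEN `U.WeilFaceAlgebraic F f` — `w ∈ W_F(P)` is a rational Hodge class
  (`Model.universeOf_fact_weilLine_hodge`), `w ⊗ 1` is a combination of complexified generators, `ofBiprod^*(w ⊗ 1)`
  is a rational `(2,2)` `K`-Weil-line class on `⨁ A`, hence algebraic, and `w ⊗ 1 = toBiprod^*(ofBiprod^*(w ⊗ 1))`
  is algebraic (`map_mem_algebraicClasses_of_abelianVariety`), i.e. `w ∈ U.alg P 2 = ratAlgebraicClasses`;
* `universeOf_faceReduction_of_riemann` — `U.FaceReduction` for the model modulo `hR` (row B02):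
  `StubTree.faceReduction_holds` over Pohlmann's span theorem and [QW8] Thm 2.5, fed exactly as in
  `Model.hc_cm_of_rows`;
* **`hc_cmProd_of_weilLineClasses_of_riemann`** (blueprint T4) with its readings `hodgeConjectureFor_cmProd_…`,
  `hodgeConjectureFor_cmProdAV_…`, `hodgeConjectureFor_of_avDominatedBy_cmProdAV_…`: for a Galois CM field `F` with
  `6 ≤ [F:ℚ]`, if for EVERY face `f` the rational `(2,2)` `K`-Weil-line classes of the corner realisations are
  algebraic, then the Hodge conjecture holds for `U.cmProd F Θ`, for the abelian variety
  `Domination.cmProdAV F h₃ n Θ = ∏_j A_{(F,Θ_j)}`, and for every abelian variety it dominates (modulo `hR`).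

What this is for: A1's T1 (`hW` at `p = 2`, `[F:ℚ] = 6`, from Markman's fourfold theorem) feeds
`weilFaceAlgebraic_of_andreSlots`; so does any other real-carrier proof of Weil-line algebraicity of corners.
References: Y. André, Progr. Math. 102 (1992) pp. 1–7; J. S. Milne, *Hodge classes on abelian varieties* (2020)
§2, Thm. 1; P. Deligne, LNM 900 (1982) §4–§5, Thm. 6.20; D. Mumford, *Abelian Varieties* §19; rfwf v3 Thm 1.3,
Lemma 8.2 / [QW8] Thm 2.5 (`CorCM/Geometry/Statements.lean`).
-/

noncomputable section

open CategoryTheory CategoryTheory.Limits NumberField MonoidalCategory Literature.AlgebraicTopology.SingularHomology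
open Literature.AlgebraicGeometry.Motives Literature.AlgebraicGeometry.HodgeTheory Literature.AlgebraicGeometry.Milne1999
open Literature.AlgebraicGeometry.ComplexMultiplication Literature.NumberTheory.Automorphic
open Literature.NumberTheory.Automorphic.PicardCM (CMCode cmRealisation BallQuotientUniformisedDatum
  CMAbelianVarietyRealised)

namespace Summit.HodgeConjecture.CorCM.Model

/-! ## §2 The model universe: `U.HC` on real carriers, and the corner realisations read over `F` -/

variable (hHD : exists_isReal_hodgeModel) (hI : hodgePQ_independent_of_hodgeModel)
variable (hU : BallQuotientUniformisedDatum) (h₃ : CMAbelianVarietyRealised)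

/-- **`U.HC X` is the tree's `HodgeConjectureFor`** for the interpretation of `X` (comparison
`Milne1999.hodgeClasses_le_ratAlgebraicClasses_iff_hodgeConjectureFor`, variety by variety; `U.alg = ratAlgebraicClasses`,
`U.hodge = BettiUniverse.hodge hHD`). [cite: Milne1999, §7 p. 72] -/
theorem universeOf_hc_iff_hodgeConjectureFor (X : PicardCM.Var) :
    (universeOf hHD hI hU h₃).HC X ↔ HodgeConjectureFor X.dim (PicardCM.Var.scheme hU h₃ X) :=
  hodgeClasses_le_ratAlgebraicClasses_iff_hodgeConjectureFor hHD hI (PicardCM.Var.isSmoothProjective hU h₃ X)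

variable (K : CMField) (Φ : Fin 4 → CMType K)

/-- **The model's `σ`-eigenline is carried by the complexification onto the joint `σ`-eigenspace of `θ_j`**:
for `y ∈ U.eigenLine F (Φ j) σ ⊂ ℂ ⊗ H¹(A_j; ℚ)`, its image `β y ∈ H¹(A_j(ℂ); ℂ)` satisfies `θ_j(e) (β y) = σ(e) β y`
(`BettiUniverse.map_eigenspaces_cmEndAction`). [cite: Deligne1982HodgeCycles, §4] -/
theorem cornerTheta_ofRatClassBaseChange (j : Fin 4) (σ : (K : Type) →+* ℂ)
    {y : (universeOf hHD hI hU h₃).CohC ((universeOf hHD hI hU h₃).cmAV K (Φ j)) 1}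
    (hy : y ∈ (universeOf hHD hI hU h₃).eigenLine K (Φ j) σ) (e : K) :
    cornerTheta h₃ K Φ j e (ofRatClassBaseChange (ComplexPoints (cornerAV h₃ K Φ j).X) 1 y) =
      σ e • ofRatClassBaseChange (ComplexPoints (cornerAV h₃ K Φ j).X) 1 y := by
  have hX := PicardCM.Var.isSmoothProjective hU h₃ (.cm (Model.cmCode K (Φ j)))
  have hmem : ofRatClassBaseChange (ComplexPoints (cornerAV h₃ K Φ j).X) 1 y ∈
      ⨅ a : (K : Type), Module.End.eigenspace (cornerTheta h₃ K Φ j a) (σ a) := by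
    rw [← BettiUniverse.map_eigenspaces_cmEndAction (cornerTheta h₃ K Φ j)
      ((cmRealisation h₃ (Model.cmCode K (Φ j))).exists_map_comp (Model.cmCodeEquiv K (Φ j))) hHD hI hX σ]
    exact ⟨y, hy, rfl⟩
  rw [Submodule.mem_iInf] at hmem
  exact (Module.End.mem_eigenspace_iff.1 (hmem e))

/-- Consequently `(act_j a)^* (β y) = σ(a) • β y` for `a ∈ 𝓞_F`. [cite: Deligne1982HodgeCycles, §4] -/
theorem map_cornerAct_ofRatClassBaseChange (j : Fin 4) (σ : (K : Type) →+* ℂ)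
    {y : (universeOf hHD hI hU h₃).CohC ((universeOf hHD hI hU h₃).cmAV K (Φ j)) 1}
    (hy : y ∈ (universeOf hHD hI hU h₃).eigenLine K (Φ j) σ) (a : 𝓞 K) :
    complexBetti.map (cornerAct h₃ K Φ j a).hom.hom.hom 1
        (ofRatClassBaseChange (ComplexPoints (cornerAV h₃ K Φ j).X) 1 y) =
      σ a • ofRatClassBaseChange (ComplexPoints (cornerAV h₃ K Φ j).X) 1 y :=
  (map_cornerAct h₃ K Φ j a _).trans (cornerTheta_ofRatClassBaseChange hHD hI hU h₃ K Φ j σ hy a)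

/-- **The complexification of a model Weil generator is a same-character cup monomial of complexified
eigenvectors** (`β` is multiplicative, `BettiUniverse.ofRatClassBaseChange_cup2`, and natural,
`HodgeModel.ofRatClassBaseChange_baseChange_map`). [folklore] -/
theorem ofRatClassBaseChange_weilGenerator
    {x : (universeOf hHD hI hU h₃).CohC ((universeOf hHD hI hU h₃).prod4 K Φ) 4}
    (hx : x ∈ (universeOf hHD hI hU h₃).weilGenerators K Φ) :
    ∃ (σ : (K : Type) →+* ℂ) (y : ∀ j, (universeOf hHD hI hU h₃).CohC ((universeOf hHD hI hU h₃).cmAV K (Φ j)) 1),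
      (∀ j, y j ∈ (universeOf hHD hI hU h₃).eigenLine K (Φ j) σ) ∧
      ofRatClassBaseChange (ComplexPoints (FourCorner.prodAV (cornerAV h₃ K Φ)).X) 4 x =
        FourCorner.gen (cornerAV h₃ K Φ)
          (fun j => ofRatClassBaseChange (ComplexPoints (cornerAV h₃ K Φ j).X) 1 (y j)) := by
  obtain ⟨σ, y, hy, rfl⟩ := hx
  refine ⟨σ, y, hy, ?_⟩
  have hpull : ∀ j, ofRatClassBaseChange (ComplexPoints (FourCorner.prodAV (cornerAV h₃ K Φ)).X) 1
      ((universeOf hHD hI hU h₃).pullC ((universeOf hHD hI hU h₃).pr4 K Φ j) 1 (y j)) =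
      complexBetti.map (FourCorner.pr (cornerAV h₃ K Φ) j).hom.hom.hom 1
        (ofRatClassBaseChange (ComplexPoints (cornerAV h₃ K Φ j).X) 1 (y j)) := fun j => by
    rw [pr_hom hHD hI hU h₃ K Φ j]
    exact HodgeModel.ofRatClassBaseChange_baseChange_map ((universeOf hHD hI hU h₃).pr4 K Φ j) 1 (y j)
  have hcup : ∀ (k : ℕ) (u v : (universeOf hHD hI hU h₃).CohC ((universeOf hHD hI hU h₃).prod4 K Φ) k),
      ofRatClassBaseChange (ComplexPoints (FourCorner.prodAV (cornerAV h₃ K Φ)).X) (k + k)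
        ((universeOf hHD hI hU h₃).cup2C ((universeOf hHD hI hU h₃).prod4 K Φ) k u v) =
      cupProduct rfl (ofRatClassBaseChange (ComplexPoints (FourCorner.prodAV (cornerAV h₃ K Φ)).X) k u)
        (ofRatClassBaseChange (ComplexPoints (FourCorner.prodAV (cornerAV h₃ K Φ)).X) k v) :=
    fun k u v => BettiUniverse.ofRatClassBaseChange_cup2 _ k u v
  unfold Universe.quadC
  rw [hcup 2, hcup 1, hcup 1, hpull 0, hpull 1, hpull 2, hpull 3]
  rfl

/-! ## §3 Blueprint T3: real-carrier Weil-line algebraicity of the corners ⟹ `U.WeilFaceAlgebraic F f` -/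

/-- **The model's Weil line consists of algebraic classes as soon as the rational `(2,2)` `K`-Weil-line classes
of the four corner realisations are algebraic** (general four types `Φ`, with the Hodge property of the Weil
line as an explicit hypothesis `hH`; for the corners of a face it is `Model.universeOf_fact_weilLine_hodge`).
Route: for `w ∈ W_F(P)`, `x := w ⊗ 1 ∈ H⁴(P(ℂ); ℂ)` is rational and of type `(2,2)` and lies in the span of the
complexified Weil generators (`ofRatClassBaseChange_weilGenerator`); `t := ofBiprod^* x` is then rational, of
type `(2,2)` (`IsOfHodgeType.map_of_isSmoothProjective`) and a `K`-Weil-line class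
(`FourCorner.map_ofBiprod_gen_mem_weilLineClasses`), hence algebraic by `hW`; and `x = toBiprod^* t`
(`toBiprod ≫ ofBiprod = 𝟙`) is algebraic (`map_mem_algebraicClasses_of_abelianVariety`), i.e.
`w ∈ ratAlgebraicClasses = U.alg`. [cite: Milne2020HodgeClassesAV, §2 and Theorem 1 (proof)]
[cite: Andre1992HodgeCM, pp. 4–5] -/
theorem weilLine_le_alg_of_weilLineClasses
    (hW : ∀ t : complexBetti (⨁ cornerAV h₃ K Φ).X (2 * 2), IsRationalClass t →
      IsOfHodgeType (⨁ cornerAV h₃ K Φ).dim (⨁ cornerAV h₃ K Φ).X (2 * 2) 2 2 t →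
      t ∈ weilLineClasses (cornerAV h₃ K Φ) (cornerAct h₃ K Φ) (2 * 2) →
      t ∈ algebraicClasses (⨁ cornerAV h₃ K Φ).X 2)
    (hH : (universeOf hHD hI hU h₃).weilLine K Φ ≤
      (universeOf hHD hI hU h₃).hodgeClassesOf ((universeOf hHD hI hU h₃).prod4 K Φ) 2) :
    (universeOf hHD hI hU h₃).weilLine K Φ ≤ (universeOf hHD hI hU h₃).alg ((universeOf hHD hI hU h₃).prod4 K Φ) 2 := by
  intro w hw
  have hX : IsSmoothProjective ((universeOf hHD hI hU h₃).dim ((universeOf hHD hI hU h₃).prod4 K Φ))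
      (FourCorner.prodAV (cornerAV h₃ K Φ)).X :=
    PicardCM.Var.isSmoothProjective hU h₃ ((universeOf hHD hI hU h₃).prod4 K Φ)
  set x : complexBetti (FourCorner.prodAV (cornerAV h₃ K Φ)).X 4 :=
    ofRatClass (ComplexPoints (FourCorner.prodAV (cornerAV h₃ K Φ)).X) 4 w with hx_def
  have hxQ : IsRationalClass x := isRationalClass_ofRatClass w
  have hxH : IsOfHodgeType ((universeOf hHD hI hU h₃).dim ((universeOf hHD hI hU h₃).prod4 K Φ))
      (FourCorner.prodAV (cornerAV h₃ K Φ)).X (2 * 2) 2 2 x :=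
    (BettiUniverse.realHodgeModel hHD hX).isOfHodgeType_of_mem_hodgeClasses hX
      (BettiUniverse.realHodgeModel_isHodgeSymmetric hHD hX) (hH hw)
  have hw' : (HodgeStructure.ofRat w : (universeOf hHD hI hU h₃).CohC ((universeOf hHD hI hU h₃).prod4 K Φ) 4) ∈
      Submodule.span ℂ ((universeOf hHD hI hU h₃).weilGenerators K Φ) := hw
  have hβx : ofRatClassBaseChange (ComplexPoints (FourCorner.prodAV (cornerAV h₃ K Φ)).X) 4
      (HodgeStructure.ofRat w) = x := by
    rw [HodgeStructure.ofRat_apply, ofRatClassBaseChange_tmul, one_smul]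
  have hxspan : x ∈ Submodule.span ℂ
      (ofRatClassBaseChange (ComplexPoints (FourCorner.prodAV (cornerAV h₃ K Φ)).X) 4 ''
        (universeOf hHD hI hU h₃).weilGenerators K Φ) := by
    rw [← Submodule.map_span, ← hβx]
    exact Submodule.mem_map_of_mem hw'
  have htW : complexBetti.map (FourCorner.ofBiprod (cornerAV h₃ K Φ)).hom.hom.hom 4 x ∈
      weilLineClasses (cornerAV h₃ K Φ) (cornerAct h₃ K Φ) 4 := by
    have hle : Submodule.span ℂ
        (ofRatClassBaseChange (ComplexPoints (FourCorner.prodAV (cornerAV h₃ K Φ)).X) 4 ''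
          (universeOf hHD hI hU h₃).weilGenerators K Φ) ≤
        (weilLineClasses (cornerAV h₃ K Φ) (cornerAct h₃ K Φ) 4).comap
          (complexBetti.map (FourCorner.ofBiprod (cornerAV h₃ K Φ)).hom.hom.hom 4).hom := by
      rw [Submodule.span_le]
      rintro _ ⟨g, hg, rfl⟩
      obtain ⟨σ, y, hy, hβ⟩ := ofRatClassBaseChange_weilGenerator hHD hI hU h₃ K Φ hg
      rw [SetLike.mem_coe, Submodule.mem_comap, hβ]
      exact FourCorner.map_ofBiprod_gen_mem_weilLineClasses (cornerAV h₃ K Φ) (cornerAct h₃ K Φ) σ _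
        (fun j a => map_cornerAct_ofRatClassBaseChange hHD hI hU h₃ K Φ j σ (hy j) a)
    exact hle hxspan
  have htQ : IsRationalClass (complexBetti.map (FourCorner.ofBiprod (cornerAV h₃ K Φ)).hom.hom.hom 4 x) :=
    hxQ.map (AlgPoints.mapContinuous (L := ℂ) (FourCorner.ofBiprod (cornerAV h₃ K Φ)).hom.hom.hom)
  have htH : IsOfHodgeType (⨁ cornerAV h₃ K Φ).dim (⨁ cornerAV h₃ K Φ).X (2 * 2) 2 2
      (complexBetti.map (FourCorner.ofBiprod (cornerAV h₃ K Φ)).hom.hom.hom 4 x) :=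
    hxH.map_of_isSmoothProjective (AbelianVariety.isSmoothProjective_holds (A := ⨁ cornerAV h₃ K Φ)) hX
      (FourCorner.ofBiprod (cornerAV h₃ K Φ)).hom.hom.hom
  have halg : complexBetti.map (FourCorner.ofBiprod (cornerAV h₃ K Φ)).hom.hom.hom 4 x ∈
      algebraicClasses (⨁ cornerAV h₃ K Φ).X 2 := hW _ htQ htH htW
  have hback : complexBetti.map (FourCorner.toBiprod (cornerAV h₃ K Φ)).hom.hom.hom 4
      (complexBetti.map (FourCorner.ofBiprod (cornerAV h₃ K Φ)).hom.hom.hom 4 x) = x := by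
    rw [abelianVarietyHom_map_map_apply, FourCorner.toBiprod_ofBiprod]
    change complexBetti.map (𝟙 (FourCorner.prodAV (cornerAV h₃ K Φ)).X) 4 x = x
    rw [complexBetti.map_id]
    rfl
  have hxalg : x ∈ algebraicClasses (FourCorner.prodAV (cornerAV h₃ K Φ)).X 2 := by
    rw [← hback]
    exact map_mem_algebraicClasses_of_abelianVariety (p := 2) hX (⨁ cornerAV h₃ K Φ)
      (FourCorner.toBiprod (cornerAV h₃ K Φ)).hom.hom.hom halg
  exact (PicardCM.mem_ratAlgebraicClasses_iff _ 2 w).2 hxalg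

/-- **Blueprint T3 (model junction)**: for the model universe of record `U = Model.universeOf hHD hI hU h₃`, a CM
field `F` and a face `f`, IF every rational class of Hodge type `(2,2)` in the `K`-Weil-line space
`weilLineClasses A ι 4 ⊂ H⁴(⨁_j A_j; ℂ)` of the four corner realisations `A_j = A_{(F, f.corner j)}` (read over `F`)
is algebraic — the `i = corner`, `e = 1` instance of the binder `hW` of
`AndreProductForm.mem_algebraicClasses_cmTypedProduct` at `p = 2` — THEN `U.WeilFaceAlgebraic F f`.  The Hodge
property of the Weil line of a face is the model theorem `Model.universeOf_fact_weilLine_hodge` (rfwf Lemma 1.2).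
[cite: Milne2020HodgeClassesAV, §2 and Theorem 1 (proof)] [cite: Andre1992HodgeCM, pp. 4–5] -/
theorem weilFaceAlgebraic_of_weilLineClasses (f : Face K)
    (hW : ∀ t : complexBetti (⨁ cornerAV h₃ K f.corner).X (2 * 2), IsRationalClass t →
      IsOfHodgeType (⨁ cornerAV h₃ K f.corner).dim (⨁ cornerAV h₃ K f.corner).X (2 * 2) 2 2 t →
      t ∈ weilLineClasses (cornerAV h₃ K f.corner) (cornerAct h₃ K f.corner) (2 * 2) →
      t ∈ algebraicClasses (⨁ cornerAV h₃ K f.corner).X 2) :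
    (universeOf hHD hI hU h₃).WeilFaceAlgebraic K f :=
  weilLine_le_alg_of_weilLineClasses hHD hI hU h₃ K f.corner hW
    (universeOf_fact_weilLine_hodge hHD hI hU h₃ K f)

/-- T3 with the STRONGER, premise-free hypothesis `weilLineClasses ≤ algebraicClasses` for the corner family (the
shape of a slot-family theorem `weilLineClasses A act 4 ≤ algebraicClasses (⨁ A).X 2`). [cite: Andre1992HodgeCM, pp. 4–5] -/
theorem weilFaceAlgebraic_of_weilLineClasses_le (f : Face K)
    (hW : weilLineClasses (cornerAV h₃ K f.corner) (cornerAct h₃ K f.corner) (2 * 2) ≤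
      algebraicClasses (⨁ cornerAV h₃ K f.corner).X 2) :
    (universeOf hHD hI hU h₃).WeilFaceAlgebraic K f :=
  weilFaceAlgebraic_of_weilLineClasses hHD hI hU h₃ K f fun _ _ _ ht => hW ht

/-- **T3 fed by André's binder, verbatim.**  The hypothesis here is LITERALLY the binder `hW` of
`AndreProductForm.mem_algebraicClasses_cmTypedProduct` at `p = 2` for the family of the four corner realisations
`A := cornerAV h₃ F f.corner`, `Φ := f.corner`, `ι := cornerAct h₃ F f.corner` (all slot maps `i : Fin 4 → Fin 4`,
all twists `e : Fin 4 → Aut F`, injective slots of constant sum `2`) — the shape in which the blueprint target T1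
(`HOME/pub-hodgecm2-lit-andre-3/A1-BLUEPRINT.md`) is stated; the junction specialises it to `i = id`, `e = 1`
(admissibility of the untwisted corners is rfwf Lemma 1.2, `sumTwo_corner` with `CyclicSextic.sumTwo_iff_ncard_eq_two`;
`cmTypeMap 1 Φ = Φ`, `𝓞(1) = 1`) and concludes `U.WeilFaceAlgebraic F f`.
[cite: Andre1992HodgeCM, Théorème (pp. 4–5)] [cite: Milne2020HodgeClassesAV, Theorem 1 (proof)] -/
theorem weilFaceAlgebraic_of_andreSlots (f : Face K)
    (hW : ∀ (i : Fin (2 * 2) → Fin 4) (e : Fin (2 * 2) → ((K : Type) ≃+* (K : Type))),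
      Function.Injective (fun j => (i j, e j)) →
      (∀ s : (K : Type) →+* ℂ, {j : Fin (2 * 2) |
        s ∈ (PicardCM.CMCode.cmTypeMap (e j) (f.corner (i j))).1}.ncard = 2) →
      ∀ t : complexBetti (⨁ fun j => cornerAV h₃ K f.corner (i j)).X (2 * 2), IsRationalClass t →
        IsOfHodgeType (⨁ fun j => cornerAV h₃ K f.corner (i j)).dim
          (⨁ fun j => cornerAV h₃ K f.corner (i j)).X (2 * 2) 2 2 t →
        t ∈ weilLineClasses (fun j => cornerAV h₃ K f.corner (i j))
          (fun j => (cornerAct h₃ K f.corner (i j)).comp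
            (RingOfIntegers.mapRingEquiv (e j).symm).toRingHom) (2 * 2) →
        t ∈ algebraicClasses (⨁ fun j => cornerAV h₃ K f.corner (i j)).X 2) :
    (universeOf hHD hI hU h₃).WeilFaceAlgebraic K f := by
  refine weilFaceAlgebraic_of_weilLineClasses hHD hI hU h₃ K f fun t htQ htH htW => ?_
  have hinj : Function.Injective
      (fun j : Fin (2 * 2) => (id j, (fun _ : Fin (2 * 2) => RingEquiv.refl (K : Type)) j)) :=
    fun j j' h => by simpa using congrArg Prod.fst h
  have hrefl : ∀ Ψ : CMType K, PicardCM.CMCode.cmTypeMap (RingEquiv.refl (K : Type)) Ψ = Ψ :=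
    fun Ψ => Subtype.ext (Set.ext fun σ => by rw [PicardCM.CMCode.mem_cmTypeMap_iff]; rfl)
  have hsum : ∀ s : (K : Type) →+* ℂ, {j : Fin (2 * 2) |
      s ∈ (PicardCM.CMCode.cmTypeMap ((fun _ : Fin (2 * 2) => RingEquiv.refl (K : Type)) j)
        (f.corner (id j))).1}.ncard = 2 := fun s => by
    simp only [id, hrefl]
    exact (CyclicSextic.sumTwo_iff_ncard_eq_two f.corner).1 (sumTwo_corner f) s
  have hact : (fun j : Fin (2 * 2) => (cornerAct h₃ K f.corner (id j)).comp
      (RingOfIntegers.mapRingEquiv ((fun _ : Fin (2 * 2) => RingEquiv.refl (K : Type)) j).symm).toRingHom) =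
      cornerAct h₃ K f.corner := by
    funext j
    refine RingHom.ext fun a => ?_
    rw [RingHom.comp_apply]
    congr 1
  have htW' : t ∈ weilLineClasses (fun j => cornerAV h₃ K f.corner (id j))
      (fun j : Fin (2 * 2) => (cornerAct h₃ K f.corner (id j)).comp
        (RingOfIntegers.mapRingEquiv ((fun _ : Fin (2 * 2) => RingEquiv.refl (K : Type)) j).symm).toRingHom)
      (2 * 2) := by
    rw [hact]
    exact htW
  exact hW id (fun _ => RingEquiv.refl (K : Type)) hinj hsum t htQ htH htW'
/-! ## §4 Blueprint T4: `U.FaceReduction` for the model (modulo Riemann), and `U.HC (U.cmProd F Θ)` -/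

/-- **Face reduction holds in the model universe of record, modulo Riemann's theorem** (Deligne–Milne 1982
Thm 6.20, `hR`, the displayed row B02): for every Galois CM field `F` with `6 ≤ [F:ℚ]`, algebraicity of ALL
rank-four face lines `W_F(P(f))` implies `U.HC (∏_j A_{(F,Θ_j)})` for every family `Θ` — `StubTree.faceReduction_holds`
(Pohlmann's span theorem + [QW8] Thm 2.5, both kernel over the facts) fed with the model rows exactly as in
`Model.hc_cm_of_rows` (`modelAxioms_of_rows`, `universeOf_algDuality`, the nine textbook facts).
[cite: Pohlmann1968, Thm. 1] [cite: Milne2020HodgeClassesAV, Theorem 1] -/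
theorem universeOf_faceReduction_of_riemann (hR : DeligneMilne1982_Thm_6_20_full) :
    (universeOf hHD hI hU h₃).FaceReduction :=
  StubTree.faceReduction_holds (universeOf hHD hI hU h₃)
    ((universeOf hHD hI hU h₃).pohlmannSpan_of_facts
      (modelAxioms_of_rows hHD hI hU h₃ hR (universeOf_algDuality hHD hI hU h₃))
      (universeOf_fact_cupExterior hHD hI hU h₃) (universeOf_fact_cup_hodge hHD hI hU h₃)
      (universeOf_fact_pull_H0 hHD hI hU h₃) (universeOf_fact_hodge_F0 hHD hI hU h₃))
    ((universeOf hHD hI hU h₃).qw8Sufficiency_of_geometricFacts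
      (modelAxioms_of_rows hHD hI hU h₃ hR (universeOf_algDuality hHD hI hU h₃))
      (universeOf_fact_cupExterior hHD hI hU h₃) (universeOf_fact_cup_hodge hHD hI hU h₃)
      (universeOf_fact_pull_H0 hHD hI hU h₃) (universeOf_fact_hodge_F0 hHD hI hU h₃)
      (universeOf_fact_factorActDescends hHD hI hU h₃
        (modelAxioms_of_rows hHD hI hU h₃ hR (universeOf_algDuality hHD hI hU h₃)))
      (universeOf_fact_cupAlg hHD hI hU h₃) (universeOf_fact_cupAssoc hHD hI hU h₃)
      (universeOf_fact_weightDual hHD hI hU h₃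
        (modelAxioms_of_rows hHD hI hU h₃ hR (universeOf_algDuality hHD hI hU h₃)))
      (universeOf_fact_gysin hHD hI hU h₃))

/-- **`U.HC (U.cmProd F Θ)` from the algebraicity of all face lines of `F`** (Galois, `6 ≤ [F:ℚ]`), modulo
Riemann's theorem. [cite: Pohlmann1968, Thm. 1] [cite: Milne2020HodgeClassesAV, Theorem 1] -/
theorem hc_cmProd_of_weilFaceAlgebraic_of_riemann (hR : DeligneMilne1982_Thm_6_20_full) (hG : IsGalois ℚ K)
    (h6 : 6 ≤ Module.finrank ℚ K) (hfaces : ∀ f : Face K, (universeOf hHD hI hU h₃).WeilFaceAlgebraic K f)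
    {n : ℕ} (Θ : Fin (n + 1) → CMType K) :
    (universeOf hHD hI hU h₃).HC ((universeOf hHD hI hU h₃).cmProd K Θ) :=
  universeOf_faceReduction_of_riemann hHD hI hU h₃ hR K hG h6 hfaces n Θ

/-- **Blueprint T4 (the rung)**: for a Galois CM field `F` with `6 ≤ [F:ℚ]`, if for EVERY face `f` of `F` the
rational `(2,2)` `K`-Weil-line classes of the four corner realisations `A_{(F, f.corner j)}` (read over `F`) are
algebraic on `⨁_j A_{(F, f.corner j)}`, then the Hodge conjecture holds, in the model universe of record and in
every codimension, for every product `∏_j A_{(F,Θ_j)}` of realisations of CM types of `F` — modulo Riemann's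
theorem `hR` (row B02) only. [cite: Andre1992HodgeCM, Théorème (pp. 4–5)] [cite: Milne2020HodgeClassesAV, Theorem 1]
[cite: Pohlmann1968, Thm. 1] -/
theorem hc_cmProd_of_weilLineClasses_of_riemann (hR : DeligneMilne1982_Thm_6_20_full) (hG : IsGalois ℚ K)
    (h6 : 6 ≤ Module.finrank ℚ K)
    (hW : ∀ (f : Face K) (t : complexBetti (⨁ cornerAV h₃ K f.corner).X (2 * 2)), IsRationalClass t →
      IsOfHodgeType (⨁ cornerAV h₃ K f.corner).dim (⨁ cornerAV h₃ K f.corner).X (2 * 2) 2 2 t →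
      t ∈ weilLineClasses (cornerAV h₃ K f.corner) (cornerAct h₃ K f.corner) (2 * 2) →
      t ∈ algebraicClasses (⨁ cornerAV h₃ K f.corner).X 2)
    {n : ℕ} (Θ : Fin (n + 1) → CMType K) :
    (universeOf hHD hI hU h₃).HC ((universeOf hHD hI hU h₃).cmProd K Θ) :=
  hc_cmProd_of_weilFaceAlgebraic_of_riemann hHD hI hU h₃ K hR hG h6
    (fun f => weilFaceAlgebraic_of_weilLineClasses hHD hI hU h₃ K f (hW f)) Θ

/-- The same conclusion in the tree's own vocabulary: `HodgeConjectureFor` for the interpretation of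
`U.cmProd F Θ`, the left-nested product of the realising abelian varieties (`universeOf_hc_iff_hodgeConjectureFor`).
[cite: Milne1999, §7 p. 72] [cite: Andre1992HodgeCM, Théorème (pp. 4–5)] -/
theorem hodgeConjectureFor_cmProd_of_weilLineClasses_of_riemann (hR : DeligneMilne1982_Thm_6_20_full)
    (hG : IsGalois ℚ K) (h6 : 6 ≤ Module.finrank ℚ K)
    (hW : ∀ (f : Face K) (t : complexBetti (⨁ cornerAV h₃ K f.corner).X (2 * 2)), IsRationalClass t →
      IsOfHodgeType (⨁ cornerAV h₃ K f.corner).dim (⨁ cornerAV h₃ K f.corner).X (2 * 2) 2 2 t →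
      t ∈ weilLineClasses (cornerAV h₃ K f.corner) (cornerAct h₃ K f.corner) (2 * 2) →
      t ∈ algebraicClasses (⨁ cornerAV h₃ K f.corner).X 2)
    {n : ℕ} (Θ : Fin (n + 1) → CMType K) :
    HodgeConjectureFor ((universeOf hHD hI hU h₃).dim ((universeOf hHD hI hU h₃).cmProd K Θ))
      (PicardCM.Var.scheme hU h₃ ((universeOf hHD hI hU h₃).cmProd K Θ)) :=
  (universeOf_hc_iff_hodgeConjectureFor hHD hI hU h₃ _).1
    (hc_cmProd_of_weilLineClasses_of_riemann hHD hI hU h₃ K hR hG h6 hW Θ)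

/-! ## §5 The same on the tree's abelian varieties: `cmProdAV F h₃ n Θ` and everything it dominates -/

include hHD hI hU in
/-- **T4 for the abelian variety `Domination.cmProdAV F h₃ n Θ = ∏_j A_{(F,Θ_j)}`** (the interpretation of
`U.cmProd F Θ` is its underlying scheme, `Model.scheme_cmProd_universeOf`; dimensions agree by
`schemeDim_eq_holds`); besides `hR` it is relative to the records `hU`, `h₃` (and `hHD`, `hI`) through which the
model universe is built. [cite: Andre1992HodgeCM, Théorème (pp. 4–5)] [cite: Milne2020HodgeClassesAV, Theorem 1] -/
theorem hodgeConjectureFor_cmProdAV_of_weilLineClasses_of_riemann (hR : DeligneMilne1982_Thm_6_20_full)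
    (hG : IsGalois ℚ K) (h6 : 6 ≤ Module.finrank ℚ K)
    (hW : ∀ (f : Face K) (t : complexBetti (⨁ cornerAV h₃ K f.corner).X (2 * 2)), IsRationalClass t →
      IsOfHodgeType (⨁ cornerAV h₃ K f.corner).dim (⨁ cornerAV h₃ K f.corner).X (2 * 2) 2 2 t →
      t ∈ weilLineClasses (cornerAV h₃ K f.corner) (cornerAct h₃ K f.corner) (2 * 2) →
      t ∈ algebraicClasses (⨁ cornerAV h₃ K f.corner).X 2)
    {n : ℕ} (Θ : Fin (n + 1) → CMType K) :
    HodgeConjectureFor (Domination.cmProdAV K h₃ n Θ).dim (Domination.cmProdAV K h₃ n Θ).X := by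
  have hX : PicardCM.Var.scheme hU h₃ ((universeOf hHD hI hU h₃).cmProd K Θ) =
      (Domination.cmProdAV K h₃ n Θ).X :=
    scheme_cmProd_universeOf hHD hI hU h₃ K n Θ
  have hdim : (Domination.cmProdAV K h₃ n Θ).dim =
      (universeOf hHD hI hU h₃).dim ((universeOf hHD hI hU h₃).cmProd K Θ) := by
    rw [AbelianVariety.dim, ← hX]
    exact schemeDim_eq_holds (PicardCM.Var.isSmoothProjective hU h₃ _)
  rw [hdim, ← hX]
  exact hodgeConjectureFor_cmProd_of_weilLineClasses_of_riemann hHD hI hU h₃ K hR hG h6 hW Θ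

include hHD hI hU in
/-- **… and for every complex abelian variety DOMINATED by such a product** (`AVDominatedBy A (∏_j A_{(F,Θ_j)})`:
`s ≫ π = [N]_A`, `N ≠ 0` — e.g. every `B^a × E^b` isogenous to a product of realisations of types of `F`, and
every CM abelian variety through `Domination.avDominatedBy_cmProd_of_isOfCMType`): Hodge classes descend along
the domination (`AndreSplit.mem_algebraicClasses_of_avDominatedBy`, Mumford §19). This is the blueprint's «transfer
to tree abelian varieties `B^a × E^b` by domination». [cite: MumfordAV1970, §19 Thm. 1 and p. 169]
[cite: Andre1992HodgeCM, Théorème (pp. 4–5)] -/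
theorem hodgeConjectureFor_of_avDominatedBy_cmProdAV_of_weilLineClasses_of_riemann
    (hR : DeligneMilne1982_Thm_6_20_full) (hG : IsGalois ℚ K) (h6 : 6 ≤ Module.finrank ℚ K)
    (hW : ∀ (f : Face K) (t : complexBetti (⨁ cornerAV h₃ K f.corner).X (2 * 2)), IsRationalClass t →
      IsOfHodgeType (⨁ cornerAV h₃ K f.corner).dim (⨁ cornerAV h₃ K f.corner).X (2 * 2) 2 2 t →
      t ∈ weilLineClasses (cornerAV h₃ K f.corner) (cornerAct h₃ K f.corner) (2 * 2) →
      t ∈ algebraicClasses (⨁ cornerAV h₃ K f.corner).X 2)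
    (A : AbelianVariety ℂ) {n : ℕ} {Θ : Fin (n + 1) → CMType K}
    (hdom : Domination.AVDominatedBy A (Domination.cmProdAV K h₃ n Θ)) : HodgeConjectureFor A.dim A.X := by
  have hP := hodgeConjectureFor_cmProdAV_of_weilLineClasses_of_riemann hHD hI hU h₃ K hR hG h6 hW Θ
  exact ⟨nonempty_hodgeModel_holds (AbelianVariety.isSmoothProjective_holds (A := A)), fun p c hc hpp =>
    AndreSplit.mem_algebraicClasses_of_avDominatedBy hdom (fun c' hc' hh' => hP.2 p c' hc' hh') c hc hpp⟩

end Summit.HodgeConjecture.CorCM.Model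

end
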